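import Literature.AlgebraicGeometry.AbelianSchemes.SerreTensorPresentation
import HarnessLib

/-!
# Serre's tensor construction is an additive functor in the module: `A ⊗_𝒪 φ : A ⊗_𝒪 𝔞 ⟶ A ⊗_𝒪 𝔞′` for an `𝒪`-linear `φ : 𝔞 → 𝔞′`

Topic `AlgebraicGeometry/AbelianSchemes`, namespace `Literature.AlgebraicGeometry.AbelianSchemes.AbelianSchemeOver` (proved theorems about
the ★ constructions `matrixHom`, `serrePresentationHom`; no named fact, no `sorry`, no `instance`, no notation; any base `S`).  Cell
`hodgecm-mathlib`, F0/P6 «MOD», P6a organ (g2) FILE 7 (FILE 5 ★ `SerreTensorPresentation`); `--supports stmt-HodgeConjecture-24832`,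
count-neutral.  HC_CM is proved only modulo the 2 remaining named inputs (hLiu418, h413) until rung 0 closes; this file discharges none of them.

## Mathematics

Let `A/S` be an abelian scheme with commutative group law and an action `ι : 𝒪 → End(A)`.  A finitely generated projective `𝒪`-module is
presented as `𝔞 = E·𝒪ⁿ` by an idempotent `E ∈ Mₙ(𝒪)`, and an `𝒪`-linear map `φ : E·𝒪ⁿ → E′·𝒪ᵐ` by a matrix `P ∈ M_{m×n}(𝒪)` INTERTWINING the
idempotents, `E′ P = P E` (for the matrix `P = E′ P E` of `φ ∘ E` one has `E′P = P = PE`; this is the idempotent completion of the category of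
free modules).  FILE 5 constructed `serrePresentationHom act E hE E' hE' P : A ⊗_𝒪 𝔞 ⟶ A ⊗_𝒪 𝔞′` (`= ι ≫ [P] ≫ π′`) and proved its
properties for a two-sided intertwining pair `(P, Q)`.  Here we record, under the one-sided hypothesis `E′ P = P E` only, that
`P ↦ A ⊗_𝒪 P` is a FUNCTOR (`ι′ ∘ (A ⊗ P) = [P] ∘ ι`, identities `P = 1` and `P = E` go to `𝟙`, `A ⊗ (P′P) = (A ⊗ P′) ∘ (A ⊗ P)`), ADDITIVE
(`A ⊗ (P₁ + P₂) = (A ⊗ P₁) + (A ⊗ P₂)` in the group of homomorphisms, `A ⊗ 0 = 0`), `𝒪`-equivariant, and given on `T`-points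
`{x ∈ A(T)ⁿ : E·x = x}` by `x ↦ P·x` (B. Conrad, *Gross–Zagier revisited* §7: `M ↦ M ⊗_𝒪 A` is an additive functor).  In particular an
inclusion of invertible ideals `𝔞 ⊂ 𝔟` yields the canonical homomorphism `A ⊗_𝒪 𝔞 ⟶ A ⊗_𝒪 𝔟`.

## Contents

* §1 `matrixCompRect_add∕_zero`, `matrixHom_add : matrixHom act (P + Q) = matrixHom act P * matrixHom act Q`, `matrixHom_zero`,
  `matrixHom_intertwines_of (hP : E' * P = P * E)`;
* §2 `fixedHom_comp_ι`, `serrePresentationHom_ι_eq` (`_ ≫ ι′ = ι ≫ [P] ≫ [E′]`, any `P`), `serrePresentationHom_eq_of_mul_eq` (`P E = P′ E ⇒`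
  same map); for `hP : E' * P = P * E`: `serrePresentationHom_ι_of` (`_ ≫ ι′ = ι ≫ [P]`),
  `serrePresentationHom_self` (`P = E ↦ 𝟙`), `serrePresentationHom_one`, **`serrePresentationHom_comp_of`** (`P` then `P′` is `P′ * P`),
  **`serrePresentationHom_add`**, `serrePresentationHom_zero`, **`serreAction_comp_serrePresentationHom_of`** (equivariance),
  `serreHomEquiv_serrePresentationHom` (points: `x ↦ P·x`).

## References
* [Conrad2004GrossZagier] B. Conrad, *Gross–Zagier revisited*, MSRI Publ. 49 (2004), §7 («The Serre tensor construction»).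
* [Kottwitz1992] §5 (p. 390); [GortzWedhorn2020] Def. 9.1 (3), Prop. 9.3.
* Tree: ★ FILE 5 `AbelianSchemes/SerreTensorPresentation` and its imports.
-/

noncomputable section

universe u

open CategoryTheory CategoryTheory.Limits AlgebraicGeometry MonoidalCategory CartesianMonoidalCategory
open scoped MonObj

namespace Literature.AlgebraicGeometry.AbelianSchemes

namespace AbelianSchemeOver

variable {S : Scheme.{u}} {A : AbelianSchemeOver S} {O : Type*} [CommRing O] (act : A.RingAction O) [IsCommMonObj A.X]

/-! ## §1 Rectangular matrices: additivity and one-sided intertwining -/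

section MatrixHom

variable {m n : ℕ}

/-- `(P + Q) · x = (P · x) (Q · x)`. [cite: Kottwitz1992, §5 (p. 390)] -/
theorem matrixCompRect_add (P Q : Matrix (Fin m) (Fin n) O) {T : Over S} (x : Fin n → (T ⟶ A.X)) :
    matrixCompRect act (P + Q) x = matrixCompRect act P x * matrixCompRect act Q x := by
  funext j
  unfold matrixCompRect
  simp only [Matrix.add_apply, act.i_add, MonObj.comp_mul, Pi.mul_apply, Finset.prod_mul_distrib]

/-- `0 · x = 1`. [cite: Kottwitz1992, §5 (p. 390)] -/
theorem matrixCompRect_zero {T : Over S} (x : Fin n → (T ⟶ A.X)) : matrixCompRect act (0 : Matrix (Fin m) (Fin n) O) x = 1 := by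
  funext j
  unfold matrixCompRect
  simp only [Matrix.zero_apply, act.i_zero, MonObj.comp_one, Finset.prod_const_one, Pi.one_apply]

/-- **`[P + Q] = [P] · [Q]`** (sum of matrices ↦ product in the group `Hom(Aⁿ, Aᵐ)`). [cite: Kottwitz1992, §5 (p. 390)] -/
theorem matrixHom_add (P Q : Matrix (Fin m) (Fin n) O) : matrixHom act (P + Q) = matrixHom act P * matrixHom act Q := by
  apply (powHomEquiv A m _).injective
  rw [powHomEquiv_matrixHom, matrixCompRect_add, powHomEquiv_mul, powHomEquiv_matrixHom, powHomEquiv_matrixHom]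

/-- `[0] = 1`. [cite: Kottwitz1992, §5 (p. 390)] -/
theorem matrixHom_zero : matrixHom act (0 : Matrix (Fin m) (Fin n) O) = 1 := by
  apply (powHomEquiv A m _).injective
  rw [powHomEquiv_matrixHom, matrixCompRect_zero]
  funext k
  haveI := A.isMonHom_powProj m k
  rw [Pi.one_apply, powHomEquiv_apply, MonObj.one_comp]

/-- A one-sided intertwiner `E′ P = P E` gives `[P] ≫ [E′] = [E] ≫ [P]`. [cite: Conrad2004GrossZagier, §7] -/
theorem matrixHom_intertwines_of (E : Matrix (Fin n) (Fin n) O) (E' : Matrix (Fin m) (Fin m) O) (P : Matrix (Fin m) (Fin n) O)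
    (hP : E' * P = P * E) : matrixHom act P ≫ matrixEnd act E' = matrixEnd act E ≫ matrixHom act P := by
  rw [← matrixHom_square, ← matrixHom_square, ← matrixHom_mul, ← matrixHom_mul, hP]

end MatrixHom

/-! ## §2 `P ↦ A ⊗_𝒪 P` is an additive, `𝒪`-equivariant functor on intertwiners -/

section ModuleMap

variable {m n p : ℕ} (E : Matrix (Fin n) (Fin n) O) (hE : E * E = E) (E' : Matrix (Fin m) (Fin m) O) (hE' : E' * E' = E')
  (E'' : Matrix (Fin p) (Fin p) O) (hE'' : E'' * E'' = E'')

/-- `(A ⊗ P) ≫ ι′ = ι ≫ [P]` for a one-sided intertwiner `E′ P = P E`. [cite: Conrad2004GrossZagier, §7] -/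
@[reassoc]
theorem serrePresentationHom_ι_of (P : Matrix (Fin m) (Fin n) O) (hP : E' * P = P * E) :
    serrePresentationHom act E hE E' hE' P ≫ serreι act E' hE' = serreι act E hE ≫ matrixHom act P :=
  haveI := isMonHom_matrixEnd act E
  haveI := isMonHom_matrixEnd act E'
  fixedHom_ι (matrixEnd act E) (matrixEnd act E') (matrixEnd_idem act hE') (matrixHom act P) (matrixHom_intertwines_of act E E' P hP)

/-- `fixedHom e e′ g ≫ ι′ = ι ≫ g ≫ e′` (unconditionally). [cite: GortzWedhorn2020, Definition 9.1 (3) and Proposition 9.3] -/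
@[reassoc]
theorem fixedHom_comp_ι {B B' : AbelianSchemeOver S} (e : B.X ⟶ B.X) [IsMonHom e] (e' : B'.X ⟶ B'.X) [IsMonHom e']
    (he' : e' ≫ e' = e') (g : B.X ⟶ B'.X) : fixedHom e e' he' g ≫ fixedι e' = fixedι e ≫ g ≫ e' := by
  rw [fixedHom, Category.assoc, Category.assoc, fixedπ_comp_ι]

/-- `(A ⊗ P) ≫ ι′ = ι ≫ [P] ≫ [E′]` for ANY matrix `P` (no intertwining needed). [cite: Conrad2004GrossZagier, §7] -/
@[reassoc]
theorem serrePresentationHom_ι_eq (P : Matrix (Fin m) (Fin n) O) :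
    serrePresentationHom act E hE E' hE' P ≫ serreι act E' hE' = serreι act E hE ≫ matrixHom act P ≫ matrixEnd act E' :=
  haveI := isMonHom_matrixEnd act E
  haveI := isMonHom_matrixEnd act E'
  fixedHom_comp_ι (matrixEnd act E) (matrixEnd act E') (matrixEnd_idem act hE') (matrixHom act P)

/-- `A ⊗ P` depends only on `P E` (the restriction of `P` to `𝔞 = E·𝒪ⁿ`): `P E = P′ E ⇒ A ⊗ P = A ⊗ P′`. [cite: Conrad2004GrossZagier, §7] -/
theorem serrePresentationHom_eq_of_mul_eq (P P' : Matrix (Fin m) (Fin n) O) (h : P * E = P' * E) :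
    serrePresentationHom act E hE E' hE' P = serrePresentationHom act E hE E' hE' P' := by
  haveI := (isMonHom_serreι_serreπ act E' hE').2.2
  have key : serreι act E hE ≫ matrixHom act P = serreι act E hE ≫ matrixHom act P' := by
    rw [← serreι_comp_matrixEnd, Category.assoc, Category.assoc, ← matrixHom_square, ← matrixHom_mul, ← matrixHom_mul, h]
  rw [← cancel_mono (serreι act E' hE'), serrePresentationHom_ι_eq, serrePresentationHom_ι_eq, reassoc_of% key]

/-- `A ⊗ E = 𝟙` (the idempotent presents the identity of `𝔞`). [cite: Conrad2004GrossZagier, §7] -/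
theorem serrePresentationHom_self : serrePresentationHom act E hE E hE E = 𝟙 _ := by
  haveI := isMonHom_matrixEnd act E
  unfold serrePresentationHom
  exact fixedHom_self (matrixEnd act E) (matrixEnd_idem act hE)

/-- `A ⊗ 1ₙ = 𝟙`. [cite: Conrad2004GrossZagier, §7] -/
theorem serrePresentationHom_one : serrePresentationHom act E hE E hE (1 : Matrix (Fin n) (Fin n) O) = 𝟙 _ := by
  haveI := isMonHom_matrixEnd act E
  unfold serrePresentationHom
  rw [matrixHom_one]
  exact fixedHom_id (matrixEnd act E) (matrixEnd_idem act hE)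

/-- **Functoriality**: `(A ⊗ P) ≫ (A ⊗ P′) = A ⊗ (P′ P)` for one-sided intertwiners. [cite: Conrad2004GrossZagier, §7] -/
theorem serrePresentationHom_comp_of (P : Matrix (Fin m) (Fin n) O) (hP : E' * P = P * E) (P' : Matrix (Fin p) (Fin m) O)
    (hP' : E'' * P' = P' * E') :
    serrePresentationHom act E hE E' hE' P ≫ serrePresentationHom act E' hE' E'' hE'' P' =
      serrePresentationHom act E hE E'' hE'' (P' * P) := by
  haveI := isMonHom_matrixEnd act E
  haveI := isMonHom_matrixEnd act E'
  haveI := isMonHom_matrixEnd act E''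
  have h := (fixedHom_comp (matrixEnd act E) (matrixEnd act E') (matrixEnd_idem act hE') (matrixHom act P)
      (matrixHom_intertwines_of act E E' P hP) (matrixEnd act E'') (matrixEnd_idem act hE'') (matrixHom act P')
      (matrixHom_intertwines_of act E' E'' P' hP')).symm
  rw [← matrixHom_mul] at h
  exact h

/-- **Additivity**: `A ⊗ (P₁ + P₂) = (A ⊗ P₁) · (A ⊗ P₂)` in the group `Hom(A ⊗ 𝔞, A ⊗ 𝔞′)`. [cite: Conrad2004GrossZagier, §7] -/
theorem serrePresentationHom_add (P₁ P₂ : Matrix (Fin m) (Fin n) O) (hP₁ : E' * P₁ = P₁ * E) (hP₂ : E' * P₂ = P₂ * E) :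
    serrePresentationHom act E hE E' hE' (P₁ + P₂) =
      serrePresentationHom act E hE E' hE' P₁ * serrePresentationHom act E hE E' hE' P₂ := by
  haveI := isMonHom_matrixEnd act E
  haveI := isMonHom_matrixEnd act E'
  haveI := isCommMonObj_pow A m
  unfold serrePresentationHom
  rw [matrixHom_add]
  exact fixedHom_mul (matrixEnd act E) (matrixEnd act E') (matrixEnd_idem act hE') (matrixHom act P₁) (matrixHom act P₂)
    (matrixHom_intertwines_of act E E' P₁ hP₁) (matrixHom_intertwines_of act E E' P₂ hP₂)

/-- `A ⊗ 0 = 1` (the zero map goes to the unit homomorphism). [cite: Conrad2004GrossZagier, §7] -/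
theorem serrePresentationHom_zero : serrePresentationHom act E hE E' hE' (0 : Matrix (Fin m) (Fin n) O) = 1 := by
  haveI := isMonHom_matrixEnd act E
  haveI := isMonHom_matrixEnd act E'
  haveI := (isMonHom_serreι_serreπ act E' hE').2.2
  haveI := (isMonHom_serreι_serreπ act E' hE').1
  rw [← cancel_mono (serreι act E' hE'), serrePresentationHom_ι_of act E hE E' hE' 0 (by rw [Matrix.mul_zero, Matrix.zero_mul]),
    matrixHom_zero, MonObj.comp_one, MonObj.one_comp]

/-- **`𝒪`-equivariance** of `A ⊗ P` for a one-sided intertwiner. [cite: Conrad2004GrossZagier, §7] -/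
theorem serreAction_comp_serrePresentationHom_of (P : Matrix (Fin m) (Fin n) O) (hP : E' * P = P * E) (a : O) :
    (serreAction act E hE).i a ≫ serrePresentationHom act E hE E' hE' P =
      serrePresentationHom act E hE E' hE' P ≫ (serreAction act E' hE').i a := by
  haveI := (isMonHom_serreι_serreπ act E' hE').2.2
  have hmat : Matrix.scalar (Fin m) a * P = P * Matrix.scalar (Fin n) a := by
    ext i j
    simp only [Matrix.scalar_apply, Matrix.diagonal_mul, Matrix.mul_diagonal, mul_comm]
  have hsc : matrixHom act P ≫ matrixEnd act (Matrix.scalar (Fin m) a) = matrixEnd act (Matrix.scalar (Fin n) a) ≫ matrixHom act P := by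
    rw [← matrixHom_square, ← matrixHom_square, ← matrixHom_mul, ← matrixHom_mul, hmat]
  rw [← cancel_mono (serreι act E' hE'), Category.assoc, serrePresentationHom_ι_of act E hE E' hE' P hP,
    serreAction_i_comp_ι_assoc, Category.assoc, serreAction_i_comp_ι, serrePresentationHom_ι_of_assoc act E hE E' hE' P hP, hsc]

/-- **On points**: `A ⊗ P` sends `x = (x_k)_k ∈ {x ∈ A(T)ⁿ : E·x = x}` to `P·x`. [cite: Conrad2004GrossZagier, §7] -/
theorem serreHomEquiv_serrePresentationHom (P : Matrix (Fin m) (Fin n) O) (hP : E' * P = P * E) {T : Over S}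
    (x : T ⟶ (serreTensor act E hE).X) :
    (serreHomEquiv act E' hE' T (x ≫ serrePresentationHom act E hE E' hE' P) : Fin m → (T ⟶ A.X)) =
      matrixCompRect act P (serreHomEquiv act E hE T x : Fin n → (T ⟶ A.X)) := by
  have hx : (x ≫ serrePresentationHom act E hE E' hE' P) ≫ serreι act E' hE' = (x ≫ serreι act E hE) ≫ matrixHom act P := by
    rw [Category.assoc, serrePresentationHom_ι_of act E hE E' hE' P hP, Category.assoc]
  have hc : (serreHomEquiv act E hE T x : Fin n → (T ⟶ A.X)) = powHomEquiv A n T (x ≫ serreι act E hE) :=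
    funext fun k => serreHomEquiv_apply_coe act E hE x k
  funext j
  rw [serreHomEquiv_apply_coe, hx, ← powHomEquiv_apply, powHomEquiv_comp_matrixHom, hc]

end ModuleMap

end AbelianSchemeOver

end Literature.AlgebraicGeometry.AbelianSchemes

end
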